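import Literature.NumberTheory.GelbartRogawski1991.LocalSplittingCMGaloisTransport
import Literature.NumberTheory.GelbartRogawski1991.LocalUnitaryUndoublingTransport
import Literature.NumberTheory.GelbartRogawski1991.LocalUnitarySplittingsCMExplicit
import Literature.NumberTheory.GelbartRogawski1991.UndoublingPlaceAssembly
import Literature.NumberTheory.GelbartRogawski1991.LocalScaleModelTransportUndoubling
import Literature.NumberTheory.GelbartRogawski1991.LocalMpGaloisTwist
import Literature.NumberTheory.Automorphic.Liu2021.Def411WeilCarriersDoubling
import Literature.NumberTheory.Automorphic.UnitaryGroupDualPairLocalLine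
import HarnessLib

-- buildfix G11b-3 recipe (LEDGER B13-1/B13-3), as in the GelbartRogawski1991 siblings: elaborate sequentially so the
-- trailing `attribute [implicit_reducible]` blocks of the imports are in force (inert for the kernel).
set_option Elab.async false

/-!
# The Galois twist followed by the dilation transports the UNDOUBLED CM splittings of the lines `⟨a₀⟩`, `⟨a₁⟩`

Topic `NumberTheory/GelbartRogawski1991`; namespace `Literature.NumberTheory.GelbartRogawski1991.UnitaryDualPair.LocalSplitting`.
KERNEL ONLY: theorems; no definition, no named fact, no `sorry`.

Fix a CM field `L`, `F = L⁺`, real non-zero `dV : Fin N → L` (`T_V = diag dV`), `e : Fin N × Fin 1 ≃ Fin n`, a finite place `v`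
of `F`, a unitary idèle class character `ψ` of `L` whose Hecke character `χ = χ_ψ` is splitting, and two lines `⟨a₀⟩`, `⟨a₁⟩`
(`aᵢ ∈ F^×`).  The tree's `χ`-attached local splitting of `U(diag dV ⊗ (aᵢ))(F_v)` into `S̃p(𝕎_v)` at the Gram matrix
`𝕋ᵢ = gram e T_V (aᵢ)` is the undoubling (`undoubledSplittings`, read on `(T_W, J_W) = ((aᵢ), (aᵢ))` by `congrW`) of the
doubled CM package `cmFinLocalFamily` — literally the body of the Summit-side `chiLocalSplittingsD … aᵢ`
(`Item6OmegaChiSplitting`).  For `σ ∈ Aut(ℂ)` fixing the field of values `M_ψ` (`hσ`), `κ ∈ F_v` with `σ ∘ ψ_v = ψ_v(κ·)`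
(`hκ`) and `s ∈ F_v^×` with `s² · (a₁/a₀) = κ` (`hκs`), the map `B = D_s ∘ (f ↦ σ ∘ f)` of `𝒮(F_vⁿ)` transports the local
Weil operators along `U(T_V)(F_v) ↪ U(𝕋ᵢ ⊗ 1)(F_v)` (`localLineInl`, `g ↦ g ⊗ 1`):

  `B (ω_{𝕋₀}(S_{a₀,v}(g ⊗ 1)) f) = ω_{𝕋₁}(S_{a₁,v}(g ⊗ 1)) (B f)`      (`galDilation_toRep_congrW_undoubledSplittings_localLineInl`),

equivalently, in the currency of the twisted package `S̃p_{ψ_v(κ·)}` (`LocalMp.galTwist`),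
`D_s (ω_κ(galTwist_σ (S_{a₀,v}(g ⊗ 1))) f) = ω_{𝕋₁}(S_{a₁,v}(g ⊗ 1)) (D_s f)` (`…_galTwist`) — the transport hypothesis
`hT` of `Def411WeilCarriersGaloisTwistOmega.exists_semilinear_quot_of_galTwist_transport` at the CM sections, member by member.

Proof (bookkeeping over tree theorems).  (1) `(congrW … (undoubledSplittings … (cmFinLocalFamily …)) …).s v` IS
`localSplittingCM … v` (`undouble_finSplittings_cmFinLocalFamily_s`), i.e. `undoubleLoc` of the doubled CM datum
`localSplittingDatumCM … v addHaar` (`congrW_undoubledSplittings_cmFinLocalFamily_s`).  (2) At the DOUBLED level the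
transport `Ψ^𝔻 = e_{D_s} ∘ galTwist σ` carries `s^𝔻_{𝕋₀}` to `s^𝔻_{𝕋₁} ∘ scaleInl`
(`exists_galTwist_rescale_comp_localSplittingDatumCM_eq`: Kudla rigidity, `LocalSplittingCMGaloisTransport`), and
`scaleInl (g ⊗ 1 ⊕ 1) = (g ⊗ 1) ⊕ 1` (`inlLoc_scaleInl`, `scaleInl_localLineInl`).  (3) The operator identity so obtained on
products `f₁ ⊠ 1_{𝒪ⁿ}` descends through `undoubleLoc` (`galDilation_toRep_undoubleLoc_eq_of_transport`,
`LocalUnitaryUndoublingTransport`: `B` is box-compatible and `⊠`-cancellation).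
HC_CM is proved only modulo the printed citations of the cell's ladder until its rung 0 closes; nothing about it is claimed here.

## References
* [Liu2021] Y. Liu, Camb. J. Math. 9 (2021), Thm. 4.18 (3), proof l. 2272–2289; App. D §D.1 Step 2 (l. 5219).
* [MoeglinVignerasWaldspurger1987] C. Mœglin, M.-F. Vignéras, J.-L. Waldspurger, LNM 1291 (1987), Chap. 2 II.1 (B) and Rem. (6).
* [GelbartRogawski1991] S. Gelbart, J. Rogawski, Invent. Math. 105 (1991), §3.1 Prop. 3.1.1 p. 455 (splitting by doubling).
* [Kudla1994] S. Kudla, Israel J. Math. 87 (1994), §3 Thm. 3.1.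
-/

set_option autoImplicit false

noncomputable section

open scoped Matrix Kronecker
open NumberField IsDedekindDomain
open Literature.RepresentationTheory.HeisenbergGroup Literature.RepresentationTheory.HeisenbergGroup.SymplecticMatrix
open Literature.RepresentationTheory.MoeglinVignerasWaldspurger1987
open Literature.NumberTheory.Automorphic Literature.NumberTheory.Automorphic.UnitaryGroup
open Literature.NumberTheory.Weil1964
open Literature.RepresentationTheory.HarrisKudlaSweet1996
open Literature.NumberTheory.GaloisRepresentations
open Literature.LinearAlgebra.QuadraticForm
open Literature.NumberTheory.Automorphic.IdeleClassGroup (toHeckeCharacter)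
open Literature.NumberTheory.Automorphic.Liu2021.Def411WeilCarriers (TW JW JW_eq isSymm_TW isUnit_det_TW)
open Literature.NumberTheory.Automorphic.Liu2021.Def411WeilCarriersDoubling (lineW complexConj_lineW lineW_ne_zero
  realDiagonal_lineW diagonal_lineW)

namespace Literature.NumberTheory.GelbartRogawski1991.UnitaryDualPair.LocalSplitting

open Literature.NumberTheory.GelbartRogawski1991.GRConstruction (Fp gramR gramR_isSymm isUnit_det_gramR₀ congrW undoubledSplittings
  cmFinLocalFamily undouble_finSplittings_cmFinLocalFamily_s borelPlaceMeasure)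

/-! ## §1 Gram bookkeeping on the lines `⟨a⟩` -/

section Gram

variable (L : Type) [Field L] [NumberField L] [IsCMField L] {N n : ℕ} (e : Fin N × Fin 1 ≃ Fin n)
  (dV : Fin N → L) (hdV : ∀ i, IsCMField.complexConj L (dV i) = dV i)

omit [NumberField L] [IsCMField L] in
/-- `(t a) = t • (a)` as `1 × 1` matrices. [cite: Liu2021, App. D §D.1 Step 1 (l. 5215)] -/
theorem TW_mul (t a : (Fp L)ˣ) : TW (Fp L) (t * a) = ((t : (Fp L)ˣ) : Fp L) • TW (Fp L) a := by
  ext i j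
  fin_cases i; fin_cases j
  simp [TW, Units.val_mul]

/-- `gram e T_V (a₁) = (a₁ a₀⁻¹) • gram e T_V (a₀)`: the Gram matrices of the two lines differ by the scalar `a₁/a₀`.
[cite: GelbartRogawski1991, §3.1 p. 454] [cite: HarrisKudlaSweet1996, §1 (1.9)] -/
theorem gram_TW_eq_smul (a₀ a₁ : (Fp L)ˣ) :
    gram (Fp L) e (realDiagonal L dV hdV) (TW (Fp L) a₁) =
      ((a₁ * a₀⁻¹ : (Fp L)ˣ) : Fp L) • gram (Fp L) e (realDiagonal L dV hdV) (TW (Fp L) a₀) := by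
  have h : TW (Fp L) a₁ = ((a₁ * a₀⁻¹ : (Fp L)ˣ) : Fp L) • TW (Fp L) a₀ := by
    rw [← TW_mul L (a₁ * a₀⁻¹) a₀, inv_mul_cancel_right]
  change Matrix.reindex e e (realDiagonal L dV hdV ⊗ₖ TW (Fp L) a₁) =
    ((a₁ * a₀⁻¹ : (Fp L)ˣ) : Fp L) • Matrix.reindex e e (realDiagonal L dV hdV ⊗ₖ TW (Fp L) a₀)
  rw [h, Matrix.kronecker_smul]
  rfl

/-- `gram e T_V (a)` is a diagonal matrix (`T_V = diag dV`, `(a)` is `1 × 1`): `gram e T_V (a) = diagonal (its diagonal)`.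
[cite: GelbartRogawski1991, §3.1 p. 454] -/
theorem gram_TW_eq_diagonal (a : (Fp L)ˣ) :
    gram (Fp L) e (realDiagonal L dV hdV) (TW (Fp L) a) =
      Matrix.diagonal (Matrix.diag (gram (Fp L) e (realDiagonal L dV hdV) (TW (Fp L) a))) := by
  have hd : (gram (Fp L) e (realDiagonal L dV hdV) (TW (Fp L) a)).IsDiag := by
    change (Matrix.reindex e e (realDiagonal L dV hdV ⊗ₖ TW (Fp L) a)).IsDiag
    rw [Matrix.reindex_apply]
    exact ((Matrix.isDiag_diagonal _).kronecker (Matrix.isDiag_of_subsingleton _)).submatrix e.symm.injective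
  exact hd.diagonal_diag.symm

end Gram

/-! ## §2 The undoubled CM section read on `(T_W, J_W)` IS `localSplittingCM`; `g ⊗ 1` under the retyping -/

section Sections

variable (L : Type) [Field L] [NumberField L] [IsCMField L] {N n : ℕ} (e : Fin N × Fin 1 ≃ Fin n)
  (dV : Fin N → L) (hdV : ∀ i, IsCMField.complexConj L (dV i) = dV i) (hdV0 : ∀ i, dV i ≠ 0)
  (dW : Fin 1 → L) (hdW : ∀ i, IsCMField.complexConj L (dW i) = dW i) (hdW0 : ∀ i, dW i ≠ 0)
  (χ : HeckeCharacter L) (hχ : IsSplittingChar L 1 χ)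

/-- **the `χ`-attached undoubled CM section, read on Gram data `(T_W, J_W)` by `congrW`, IS `localSplittingCM` at
`gram e T_V T_W`** (the undoubling `undoubleLoc` of the doubled CM datum `localSplittingDatumCM … v addHaar`, Borel σ-algebra):
`undouble_finSplittings_cmFinLocalFamily_s` transported along `realDiagonal (lineW T_W) = T_W`, `diagonal (lineW T_W) = J_W`.
[cite: GelbartRogawski1991, §3.1 Prop. 3.1.1 p. 455 L1–3] [cite: Liu2021, App. D §D.1 Step 2 (l. 5219)] -/
theorem congrW_undoubledSplittings_cmFinLocalFamily_s {TW' : Matrix (Fin 1) (Fin 1) (Fp L)} {JW' : Matrix (Fin 1) (Fin 1) L}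
    (hT : realDiagonal L dW hdW = TW') (hJ : Matrix.diagonal dW = JW') (hW' : TW'.IsSymm) (hW'd : IsUnit TW'.det)
    (hJW' : JW' = TW'.map (algebraMap (Fp L) L)) (v : HeightOneSpectrum (𝓞 (Fp L))) :
    (congrW L e dV hdV dW hdW hT hJ
        (undoubledSplittings L e dV hdV hdV0 dW hdW hdW0 χ (borelPlaceMeasure L)
          (cmFinLocalFamily L e dV hdV hdV0 dW hdW hdW0 χ hχ (borelPlaceMeasure L))) hW' hJW').s v =
      localSplittingCM L n (isSymm_gram (Fp L) e (realDiagonal_isSymm L dV hdV) hW')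
        (isUnit_det_gram (Fp L) e (isUnit_det_realDiagonal L dV hdV hdV0) hW'd)
        (reindex_kronecker_eq_gram_map (Fp L) L e (realDiagonal_map L dV hdV).symm hJW') χ hχ v := by
  subst hT hJ
  exact undouble_finSplittings_cmFinLocalFamily_s L e dV hdV hdV0 dW hdW hdW0 χ hχ _ v

/-- **`g ⊗ 1` does not see the retyping `U(𝕋₀ ⊗ 1) = U(𝕋₁ ⊗ 1)`**: `scaleInl (g ⊗ 1) = g ⊗ 1` for the two lines
`J_W = (a₀)`, `(a₁)` (same family of matrices `k_w ⊗ 1`). [cite: GelbartRogawski1991, §3.1 p. 454 and §3.2 p. 457] -/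
theorem scaleInl_localLineInl {T₀ T₁ : Matrix (Fin n) (Fin n) (Fp L)} (t : (Fp L)ˣ) (hTT : T₁ = (t : Fp L) • T₀)
    (a₀ a₁ : (Fp L)ˣ)
    (hJ₀ : Matrix.reindex e e (Matrix.diagonal dV ⊗ₖ JW (Fp L) L a₀) = T₀.map (algebraMap (Fp L) L))
    (hJ₁ : Matrix.reindex e e (Matrix.diagonal dV ⊗ₖ JW (Fp L) L a₁) = T₁.map (algebraMap (Fp L) L))
    (v : HeightOneSpectrum (𝓞 (Fp L))) (g : localPi L (IsCMField.complexConj L) N (Matrix.diagonal dV) v) :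
    scaleInl (Fp L) L (IsCMField.complexConj L) n T₀ T₁ t hTT hJ₀ hJ₁ v
        (localLineInl L (IsCMField.complexConj L) N e (Matrix.diagonal dV) (JW (Fp L) L a₀) v g) =
      localLineInl L (IsCMField.complexConj L) N e (Matrix.diagonal dV) (JW (Fp L) L a₁) v g :=
  Subtype.ext (by rw [coe_scaleInl, coe_localLineInl, coe_localLineInl])

end Sections

/-! ## §3 The transport identity at the undoubled CM sections -/

section Transport

variable (L : Type) [Field L] [NumberField L] [IsCMField L] {N n : ℕ} (e : Fin N × Fin 1 ≃ Fin n) (hn : 0 < n)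
  (dV : Fin N → L) (hdV : ∀ i, IsCMField.complexConj L (dV i) = dV i) (hdV0 : ∀ i, dV i ≠ 0)
  (v : HeightOneSpectrum (𝓞 (Fp L)))
  (ψ : IdeleClassGroup L →ₜ* Circle) (hχ : IsSplittingChar L 1 (toHeckeCharacter L ψ))
  (σ : ℂ ≃+* ℂ) (hσ : ∀ z ∈ Liu2021.fieldOfValues L ψ, σ z = z)
  (κ : v.adicCompletion (Fp L))
  (hκ : ∀ r : v.adicCompletion (Fp L),
    (σ : ℂ →+* ℂ) ((adeleAddCharAt (Fp L) v r : Circle) : ℂ) = ((adeleAddCharAt (Fp L) v (κ * r) : Circle) : ℂ))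
  (s : (v.adicCompletion (Fp L))ˣ) (a₀ a₁ : (Fp L)ˣ)
  (hκs : (s : v.adicCompletion (Fp L)) * s *
    algebraMap (Fp L) (v.adicCompletion (Fp L)) ((a₁ : Fp L) * (a₀ : Fp L)⁻¹) = κ)

-- heartbeats: the statement alone (two undoubled CM packages spelled in full) exceeds the default budget, as in the
-- sibling `LocalLineIsometryNaturality`.
set_option maxHeartbeats 1600000 in
include hn hσ hκ hκs in
/-- **THE GALOIS TWIST FOLLOWED BY THE DILATION TRANSPORTS THE UNDOUBLED CM SPLITTINGS OF THE LINES `⟨a₀⟩ → ⟨a₁⟩`.**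
For `g ∈ U(diag dV)(F_v)` and `f ∈ 𝒮(F_vⁿ)`, with `B = D_s ∘ (f ↦ σ ∘ f)`, `s² (a₁/a₀) = κ`, `σ ∘ ψ_v = ψ_v(κ·)`, `σ|_{M_ψ} = id`:
`B (ω_{𝕋₀}(S_{a₀,v}(g ⊗ 1)) f) = ω_{𝕋₁}(S_{a₁,v}(g ⊗ 1)) (B f)`, where `S_{a,v}` is the `χ_ψ`-attached undoubled CM local
splitting of `U(diag dV ⊗ (a))(F_v)` (the body of `chiLocalSplittingsD … a`) and `𝕋ᵢ = gram e T_V (aᵢ)`.  From the doubled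
transport `exists_galTwist_rescale_comp_localSplittingDatumCM_eq` (Kudla rigidity) by descent through `undoubleLoc`
(`galDilation_toRep_undoubleLoc_eq_of_transport`).
[cite: Liu2021, Thm. 4.18 (3), proof l. 2272–2289] [cite: MoeglinVignerasWaldspurger1987, Chap. 2 II.1 (B) and Rem. (6)]
[cite: GelbartRogawski1991, §3.1 Prop. 3.1.1 p. 455 L1–3] [cite: Kudla1994, §3 Thm. 3.1] -/
theorem galDilation_toRep_congrW_undoubledSplittings_localLineInl
    (g : localPi L (IsCMField.complexConj L) N (Matrix.diagonal dV) v)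
    (f : SchwartzBruhat (Fin n → v.adicCompletion (Fp L))) :
    leviEquivSB (LinearEquiv.smulOfUnit s : (Fin n → v.adicCompletion (Fp L)) ≃ₗ[v.adicCompletion (Fp L)]
          (Fin n → v.adicCompletion (Fp L))) (continuous_const_smul (s : v.adicCompletion (Fp L)))
        (continuous_const_smul ((s⁻¹ : (v.adicCompletion (Fp L))ˣ) : v.adicCompletion (Fp L)))
        (schwartzGalConj (σ : ℂ →+* ℂ)
          (MpPsi.toRep (localSchrodinger (Fp L) n (gram (Fp L) e (realDiagonal L dV hdV) (TW (Fp L) a₀)) v)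
            ((congrW L e dV hdV (lineW L (TW (Fp L) a₀)) (complexConj_lineW L (TW (Fp L) a₀))
                (realDiagonal_lineW L (TW (Fp L) a₀)) (diagonal_lineW L (TW (Fp L) a₀) (JW_eq (Fp L) L a₀))
                (undoubledSplittings L e dV hdV hdV0 (lineW L (TW (Fp L) a₀)) (complexConj_lineW L (TW (Fp L) a₀))
                  (lineW_ne_zero L (TW (Fp L) a₀) (isUnit_det_TW (Fp L) a₀)) (toHeckeCharacter L ψ) (borelPlaceMeasure L)
                  (cmFinLocalFamily L e dV hdV hdV0 (lineW L (TW (Fp L) a₀)) (complexConj_lineW L (TW (Fp L) a₀))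
                    (lineW_ne_zero L (TW (Fp L) a₀) (isUnit_det_TW (Fp L) a₀)) (toHeckeCharacter L ψ) hχ
                    (borelPlaceMeasure L)))
                (isSymm_TW (Fp L) a₀) (JW_eq (Fp L) L a₀)).s v
              (localLineInl L (IsCMField.complexConj L) N e (Matrix.diagonal dV) (JW (Fp L) L a₀) v g))
            f)) =
      MpPsi.toRep (localSchrodinger (Fp L) n (gram (Fp L) e (realDiagonal L dV hdV) (TW (Fp L) a₁)) v)
        ((congrW L e dV hdV (lineW L (TW (Fp L) a₁)) (complexConj_lineW L (TW (Fp L) a₁))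
            (realDiagonal_lineW L (TW (Fp L) a₁)) (diagonal_lineW L (TW (Fp L) a₁) (JW_eq (Fp L) L a₁))
            (undoubledSplittings L e dV hdV hdV0 (lineW L (TW (Fp L) a₁)) (complexConj_lineW L (TW (Fp L) a₁))
              (lineW_ne_zero L (TW (Fp L) a₁) (isUnit_det_TW (Fp L) a₁)) (toHeckeCharacter L ψ) (borelPlaceMeasure L)
              (cmFinLocalFamily L e dV hdV hdV0 (lineW L (TW (Fp L) a₁)) (complexConj_lineW L (TW (Fp L) a₁))
                (lineW_ne_zero L (TW (Fp L) a₁) (isUnit_det_TW (Fp L) a₁)) (toHeckeCharacter L ψ) hχ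
                (borelPlaceMeasure L)))
            (isSymm_TW (Fp L) a₁) (JW_eq (Fp L) L a₁)).s v
          (localLineInl L (IsCMField.complexConj L) N e (Matrix.diagonal dV) (JW (Fp L) L a₁) v g))
        (leviEquivSB (LinearEquiv.smulOfUnit s : (Fin n → v.adicCompletion (Fp L)) ≃ₗ[v.adicCompletion (Fp L)]
            (Fin n → v.adicCompletion (Fp L))) (continuous_const_smul (s : v.adicCompletion (Fp L)))
          (continuous_const_smul ((s⁻¹ : (v.adicCompletion (Fp L))ˣ) : v.adicCompletion (Fp L)))
          (schwartzGalConj (σ : ℂ →+* ℂ) f)) := by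
  letI : MeasurableSpace (v.adicCompletion (Fp L)) := borel _
  haveI : BorelSpace (v.adicCompletion (Fp L)) := ⟨rfl⟩
  -- the Gram data of the two lines: `𝕋₁ = (a₁/a₀) • 𝕋₀`, `s² (a₁/a₀) = κ`
  have hTT₀ := gram_TW_eq_smul L e dV hdV a₀ a₁
  have hκs' : (s : v.adicCompletion (Fp L)) * s *
      algebraMap (Fp L) (v.adicCompletion (Fp L)) ((a₁ * a₀⁻¹ : (Fp L)ˣ) : Fp L) = κ := by
    rw [Units.val_mul, Units.val_inv_eq_inv_val]; exact hκs
  -- (1) the two undoubled CM sections ARE `localSplittingCM … v = undoubleLoc (s^𝔻_{𝕋ᵢ, addHaar}) …`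
  rw [congrW_undoubledSplittings_cmFinLocalFamily_s L e dV hdV hdV0 (lineW L (TW (Fp L) a₀))
      (complexConj_lineW L (TW (Fp L) a₀)) (lineW_ne_zero L (TW (Fp L) a₀) (isUnit_det_TW (Fp L) a₀))
      (toHeckeCharacter L ψ) hχ (realDiagonal_lineW L (TW (Fp L) a₀)) (diagonal_lineW L (TW (Fp L) a₀) (JW_eq (Fp L) L a₀))
      (isSymm_TW (Fp L) a₀) (isUnit_det_TW (Fp L) a₀) (JW_eq (Fp L) L a₀) v,
    congrW_undoubledSplittings_cmFinLocalFamily_s L e dV hdV hdV0 (lineW L (TW (Fp L) a₁))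
      (complexConj_lineW L (TW (Fp L) a₁)) (lineW_ne_zero L (TW (Fp L) a₁) (isUnit_det_TW (Fp L) a₁))
      (toHeckeCharacter L ψ) hχ (realDiagonal_lineW L (TW (Fp L) a₁)) (diagonal_lineW L (TW (Fp L) a₁) (JW_eq (Fp L) L a₁))
      (isSymm_TW (Fp L) a₁) (isUnit_det_TW (Fp L) a₁) (JW_eq (Fp L) L a₁) v]
  -- (2) the DOUBLED transport `Ψ^𝔻 = e_{D_s} ∘ galTwist σ`: `Ψ^𝔻 ∘ s^𝔻_{𝕋₀} = s^𝔻_{𝕋₁} ∘ scaleInl` (Kudla rigidity)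
  obtain ⟨ΨD, -, hΨop, hΨS⟩ := exists_galTwist_rescale_comp_localSplittingDatumCM_eq L v MeasureTheory.Measure.addHaar n hn
    (Matrix.diag (gram (Fp L) e (realDiagonal L dV hdV) (TW (Fp L) a₀))) (gram_TW_eq_diagonal L e dV hdV a₀)
    (isSymm_gram (Fp L) e (realDiagonal_isSymm L dV hdV) (isSymm_TW (Fp L) a₀))
    (isUnit_det_gram (Fp L) e (isUnit_det_realDiagonal L dV hdV hdV0) (isUnit_det_TW (Fp L) a₀)) (a₁ * a₀⁻¹) hTT₀
    (isSymm_gram (Fp L) e (realDiagonal_isSymm L dV hdV) (isSymm_TW (Fp L) a₁))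
    (isUnit_det_gram (Fp L) e (isUnit_det_realDiagonal L dV hdV hdV0) (isUnit_det_TW (Fp L) a₁)) rfl rfl ψ hχ σ hσ κ hκ s hκs'
  -- a non-zero second test vector `1_{𝒪_vⁿ}`
  have hne : (unitVec (Fp L) (Fin n) v : SchwartzBruhat (Fin n → v.adicCompletion (Fp L))) ≠ 0 := fun h0 => by
    have h1 : ((unitVec (Fp L) (Fin n) v : SchwartzBruhat (Fin n → v.adicCompletion (Fp L))) :
        (Fin n → v.adicCompletion (Fp L)) → ℂ) 0 = 1 :=
      unitVec_apply_of_mem fun i _ => (v.adicCompletionIntegers (Fp L)).zero_mem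
    rw [h0, ZeroMemClass.coe_zero, Pi.zero_apply] at h1
    exact zero_ne_one h1
  -- (3) descent through `undoubleLoc` (`⊠ 1_{𝒪ⁿ}`-cancellation; `B = D_s ∘ (σ ∘ ·)` is box-compatible)
  refine galDilation_toRep_undoubleLoc_eq_of_transport (Fp L) L (IsCMField.complexConj L) v n
    (reindex_kronecker_eq_gram_map (Fp L) L e (realDiagonal_map L dV hdV).symm (JW_eq (Fp L) L a₀)) rfl
    (reindex_kronecker_eq_gram_map (Fp L) L e (realDiagonal_map L dV hdV).symm (JW_eq (Fp L) L a₁)) rfl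
    (complexConj_imagUnit L) (imagUnit_ne_zero L) (imagUnit_mul_self L)
    (isSymm_gram (Fp L) e (realDiagonal_isSymm L dV hdV) (isSymm_TW (Fp L) a₀))
    (isUnit_det_gram (Fp L) e (isUnit_det_realDiagonal L dV hdV hdV0) (isUnit_det_TW (Fp L) a₀))
    (isSymm_gram (Fp L) e (realDiagonal_isSymm L dV hdV) (isSymm_TW (Fp L) a₁))
    (isUnit_det_gram (Fp L) e (isUnit_det_realDiagonal L dV hdV hdV0) (isUnit_det_TW (Fp L) a₁))
    (localSplittingDatumCM L v MeasureTheory.Measure.addHaar n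
      (isSymm_gram (Fp L) e (realDiagonal_isSymm L dV hdV) (isSymm_TW (Fp L) a₀))
      (isUnit_det_gram (Fp L) e (isUnit_det_realDiagonal L dV hdV hdV0) (isUnit_det_TW (Fp L) a₀)) rfl
      (toHeckeCharacter L ψ) hχ).localSplitting
    (fun k => (localSplittingDatumCM L v MeasureTheory.Measure.addHaar n
      (isSymm_gram (Fp L) e (realDiagonal_isSymm L dV hdV) (isSymm_TW (Fp L) a₀))
      (isUnit_det_gram (Fp L) e (isUnit_det_realDiagonal L dV hdV hdV0) (isUnit_det_TW (Fp L) a₀)) rfl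
      (toHeckeCharacter L ψ) hχ).proj_localSplitting k)
    (localSplittingDatumCM L v MeasureTheory.Measure.addHaar n
      (isSymm_gram (Fp L) e (realDiagonal_isSymm L dV hdV) (isSymm_TW (Fp L) a₁))
      (isUnit_det_gram (Fp L) e (isUnit_det_realDiagonal L dV hdV hdV0) (isUnit_det_TW (Fp L) a₁)) rfl
      (toHeckeCharacter L ψ) hχ).localSplitting
    (fun k => (localSplittingDatumCM L v MeasureTheory.Measure.addHaar n
      (isSymm_gram (Fp L) e (realDiagonal_isSymm L dV hdV) (isSymm_TW (Fp L) a₁))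
      (isUnit_det_gram (Fp L) e (isUnit_det_realDiagonal L dV hdV hdV0) (isUnit_det_TW (Fp L) a₁)) rfl
      (toHeckeCharacter L ψ) hχ).proj_localSplitting k)
    (σ : ℂ →+* ℂ) s hne
    (localLineInl L (IsCMField.complexConj L) N e (Matrix.diagonal dV) (JW (Fp L) L a₀) v g)
    (localLineInl L (IsCMField.complexConj L) N e (Matrix.diagonal dV) (JW (Fp L) L a₁) v g)
    (fun f₁ => ?_) f
  -- the doubled operator identity at `(g ⊗ 1) ⊕ 1`: `scaleInl ((g ⊗ 1) ⊕ 1) = (g ⊗ 1) ⊕ 1` and `Ψ^𝔻 ∘ s^𝔻_{𝕋₀} = s^𝔻_{𝕋₁} ∘ scaleInl`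
  have hg : inlLoc (Fp L) L (IsCMField.complexConj L) v n
        (reindex_kronecker_eq_gram_map (Fp L) L e (realDiagonal_map L dV hdV).symm (JW_eq (Fp L) L a₁)) rfl
        (localLineInl L (IsCMField.complexConj L) N e (Matrix.diagonal dV) (JW (Fp L) L a₁) v g) =
      scaleInl (Fp L) L (IsCMField.complexConj L) (n + n) (gramD (Fp L) n (gram (Fp L) e (realDiagonal L dV hdV) (TW (Fp L) a₀)))
        (gramD (Fp L) n (gram (Fp L) e (realDiagonal L dV hdV) (TW (Fp L) a₁))) (a₁ * a₀⁻¹)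
        (gramD_of_eq_smul (Fp L) (a₁ * a₀⁻¹) hTT₀) rfl rfl v
        (inlLoc (Fp L) L (IsCMField.complexConj L) v n
          (reindex_kronecker_eq_gram_map (Fp L) L e (realDiagonal_map L dV hdV).symm (JW_eq (Fp L) L a₀)) rfl
          (localLineInl L (IsCMField.complexConj L) N e (Matrix.diagonal dV) (JW (Fp L) L a₀) v g)) :=
    Subtype.ext (funext fun w => by rw [inlLoc_apply, coe_scaleInl, inlLoc_apply]; rfl)
  have hS := DFunLike.congr_fun hΨS
    (inlLoc (Fp L) L (IsCMField.complexConj L) v n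
      (reindex_kronecker_eq_gram_map (Fp L) L e (realDiagonal_map L dV hdV).symm (JW_eq (Fp L) L a₀)) rfl
      (localLineInl L (IsCMField.complexConj L) N e (Matrix.diagonal dV) (JW (Fp L) L a₀) v g))
  rw [MonoidHom.comp_apply, MonoidHom.comp_apply, ← hg] at hS
  exact (hΨop _ _).symm.trans (congrArg (fun y => MpPsi.toRep _ y _) hS)

-- heartbeats: as above.
set_option maxHeartbeats 1600000 in
include hn hσ hκs in
/-- **the same in the currency of the twisted package `S̃p_{ψ_v(κ·)}(𝕎_v)`** (`LocalMp.galTwist`): for `g ∈ U(diag dV)(F_v)`,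
`f ∈ 𝒮(F_vⁿ)`, `D_s (ω_κ(galTwist_σ(S_{a₀,v}(g ⊗ 1))) f) = ω_{𝕋₁}(S_{a₁,v}(g ⊗ 1)) (D_s f)` — the transport hypothesis of
`Def411WeilCarriersGaloisTwistOmega.exists_semilinear_quot_of_galTwist_transport` at the CM sections (`D = D_s`), by
`ω(galTwist p) f = σ ∘ (ω(p)(σ⁻¹ ∘ f))` (`LocalMp.toRep_galTwist_apply`).
[cite: Liu2021, Thm. 4.18 (3), proof l. 2272–2289] [cite: MoeglinVignerasWaldspurger1987, Chap. 2 II.1 (B) and Rem. (6)]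
[cite: GelbartRogawski1991, §3.1 Prop. 3.1.1 p. 455 L1–3] [cite: Kudla1994, §3 Thm. 3.1] -/
theorem galDilation_toRep_galTwist_congrW_undoubledSplittings_localLineInl
    (g : localPi L (IsCMField.complexConj L) N (Matrix.diagonal dV) v)
    (f : SchwartzBruhat (Fin n → v.adicCompletion (Fp L))) :
    leviEquivSB (LinearEquiv.smulOfUnit s : (Fin n → v.adicCompletion (Fp L)) ≃ₗ[v.adicCompletion (Fp L)]
          (Fin n → v.adicCompletion (Fp L))) (continuous_const_smul (s : v.adicCompletion (Fp L)))
        (continuous_const_smul ((s⁻¹ : (v.adicCompletion (Fp L))ˣ) : v.adicCompletion (Fp L)))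
        (MpPsi.toRep (localSchrodingerMulShift (Fp L) n (gram (Fp L) e (realDiagonal L dV hdV) (TW (Fp L) a₀)) v κ)
          (LocalMp.galTwist (Fp L) n (gram (Fp L) e (realDiagonal L dV hdV) (TW (Fp L) a₀)) v (σ : ℂ →+* ℂ)
            (σ.symm : ℂ →+* ℂ) σ.apply_symm_apply σ.symm_apply_apply κ hκ
            ((congrW L e dV hdV (lineW L (TW (Fp L) a₀)) (complexConj_lineW L (TW (Fp L) a₀))
                (realDiagonal_lineW L (TW (Fp L) a₀)) (diagonal_lineW L (TW (Fp L) a₀) (JW_eq (Fp L) L a₀))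
                (undoubledSplittings L e dV hdV hdV0 (lineW L (TW (Fp L) a₀)) (complexConj_lineW L (TW (Fp L) a₀))
                  (lineW_ne_zero L (TW (Fp L) a₀) (isUnit_det_TW (Fp L) a₀)) (toHeckeCharacter L ψ) (borelPlaceMeasure L)
                  (cmFinLocalFamily L e dV hdV hdV0 (lineW L (TW (Fp L) a₀)) (complexConj_lineW L (TW (Fp L) a₀))
                    (lineW_ne_zero L (TW (Fp L) a₀) (isUnit_det_TW (Fp L) a₀)) (toHeckeCharacter L ψ) hχ
                    (borelPlaceMeasure L)))
                (isSymm_TW (Fp L) a₀) (JW_eq (Fp L) L a₀)).s v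
              (localLineInl L (IsCMField.complexConj L) N e (Matrix.diagonal dV) (JW (Fp L) L a₀) v g)))
          f) =
      MpPsi.toRep (localSchrodinger (Fp L) n (gram (Fp L) e (realDiagonal L dV hdV) (TW (Fp L) a₁)) v)
        ((congrW L e dV hdV (lineW L (TW (Fp L) a₁)) (complexConj_lineW L (TW (Fp L) a₁))
            (realDiagonal_lineW L (TW (Fp L) a₁)) (diagonal_lineW L (TW (Fp L) a₁) (JW_eq (Fp L) L a₁))
            (undoubledSplittings L e dV hdV hdV0 (lineW L (TW (Fp L) a₁)) (complexConj_lineW L (TW (Fp L) a₁))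
              (lineW_ne_zero L (TW (Fp L) a₁) (isUnit_det_TW (Fp L) a₁)) (toHeckeCharacter L ψ) (borelPlaceMeasure L)
              (cmFinLocalFamily L e dV hdV hdV0 (lineW L (TW (Fp L) a₁)) (complexConj_lineW L (TW (Fp L) a₁))
                (lineW_ne_zero L (TW (Fp L) a₁) (isUnit_det_TW (Fp L) a₁)) (toHeckeCharacter L ψ) hχ
                (borelPlaceMeasure L)))
            (isSymm_TW (Fp L) a₁) (JW_eq (Fp L) L a₁)).s v
          (localLineInl L (IsCMField.complexConj L) N e (Matrix.diagonal dV) (JW (Fp L) L a₁) v g))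
        (leviEquivSB (LinearEquiv.smulOfUnit s : (Fin n → v.adicCompletion (Fp L)) ≃ₗ[v.adicCompletion (Fp L)]
            (Fin n → v.adicCompletion (Fp L))) (continuous_const_smul (s : v.adicCompletion (Fp L)))
          (continuous_const_smul ((s⁻¹ : (v.adicCompletion (Fp L))ˣ) : v.adicCompletion (Fp L))) f) := by
  have h := galDilation_toRep_congrW_undoubledSplittings_localLineInl L e hn dV hdV hdV0 v ψ hχ σ hσ κ hκ s a₀ a₁ hκs g
    (schwartzGalConj (σ.symm : ℂ →+* ℂ) f)
  rw [schwartzGalConj_schwartzGalConj (σ : ℂ →+* ℂ) (σ.symm : ℂ →+* ℂ) σ.apply_symm_apply] at h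
  rw [LocalMp.toRep_galTwist_apply (Fp L) n (gram (Fp L) e (realDiagonal L dV hdV) (TW (Fp L) a₀)) v (σ : ℂ →+* ℂ)
    (σ.symm : ℂ →+* ℂ) σ.apply_symm_apply σ.symm_apply_apply κ hκ _ f]
  exact h

end Transport

end Literature.NumberTheory.GelbartRogawski1991.UnitaryDualPair.LocalSplitting

end
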